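import Mathlib
import Literature.RingTheory.CohomologyAnnihilator.CompletionTheorem
import Literature.RingTheory.CohomologyAnnihilator.DualBaseChangeFlat
import Summits.ResolutionOfSingularities.ResolutionOfSingularities.Theorems.HomologicalConductorNoZenoReflexiveSyzygy
import Summits.ResolutionOfSingularities.ResolutionOfSingularities.Theorems.HomologicalConductorPersistenceConductorCeiling
import HarnessLib

/-!
# Rung S-2 `PersistenceSurface` (stmt-ResolutionOfSingularities-19970), stub C1 (`Sat₄`) — «COMPLETE HERZOG FROM
# LOCAL HERZOG»: an `add`-cover of the second syzygies ASCENDS to a completion-like extension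

[OURS · cell decomp-res · rung S-2; seat leafhand-res-homologicalconduct-15 gen 0]  Nothing here is a statement of the
manuscript under review (Hironaka 2017); AI-written, weaker than expert review.  DEF-FREE.

Brick (iv) of the level-exact completion transport of the toric `Sat₄` theorem (evidence HAND15-TRANSPORT §3).  Setting:
`S → S'` a flat local homomorphism of noetherian local rings with `𝔪S' = 𝔪'` and `S` dense in `S'` (e.g. `S' = Ŝ`),
`S'` a domain of Krull dimension `2` and an isolated singularity.  If every second syzygy module over `S` is a retract of
a power of a fixed finitely generated `V` («local Herzog», `add`-cover), then every second syzygy module over `S'` is a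
retract of a power of `S' ⊗_S V` («complete Herzog»).  Mechanism: a second syzygy `K'` over `S'` is reflexive
(`isReflexive_of_isSyzygy_two`, `S'` a domain) and punctured-free (`puncturedFree_of_isSyzygy_of_isIsolatedSingularity`,
order `2 = dim`), hence a retract of `S' ⊗ N` for some finitely generated `S`-module `N`
(`exists_retract_baseChange_of_puncturedFree`, [BahlekehHakimianSalarianTakahashi2015, Cor. 4.4 substitute]); so
`K' ≅ K'**` is a retract of `(S' ⊗ N)** ≅ S' ⊗ N**` (`isBaseChange_bidual`: double duals commute with flat base change),
and `N**` is a second syzygy over `S` (`exists_isSyzygy_two_dual`), covered by `V`.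

* `isRetractOfPower_baseChange` — `add`-membership ascends along any base change;
* `dualMap_dualMap_retract` — double duals of a retract form a retract;
* `isRetractOfPower_of_isSyzygy_two_of_completionLike` — THE TRANSFER.

References: A. Bahlekeh, E. Hakimian, S. Salarian, R. Takahashi, Q. J. Math. 67 (2016), Cor. 4.4 / Thm. 4.5
[`BahlekehHakimianSalarianTakahashi2015`]; J. Herzog, Math. Ann. 233 (1978) (the name) — tree lemmas only.
-/

-- single-problem summit: the doubled namespace component `ResolutionOfSingularities` is forced
set_option linter.dupNamespace false

noncomputable section

open CategoryTheory IsLocalRing TensorProduct Literature.RingTheory.CohomologyAnnihilator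
open Literature.RingTheory.CohomologyAnnihilator.BHST2015.CompletionAscentRetract (exists_retract_baseChange_of_puncturedFree)
open Literature.RingTheory.CohomologyAnnihilator.BHST2015.CompletionAscentIsolated
  (puncturedFree_of_isSyzygy_of_isIsolatedSingularity)
open Summit.ResolutionOfSingularities.ResolutionOfSingularities.Theorems.NoZeno.SandwichCluster (isReflexive_of_isSyzygy_two)
open Summit.ResolutionOfSingularities.ResolutionOfSingularities.Theorems.HomologicalConductor.PersistenceConductorCeiling
  (exists_isSyzygy_two_dual)

universe u

namespace Summit.ResolutionOfSingularities.ResolutionOfSingularities.Theorems.HomologicalConductor.PersistenceSurfaceCompleteHerzogTransfer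

variable {S : Type u} [CommRing S] (S' : Type u) [CommRing S'] [Algebra S S']

/-! ## Two bricks -/

/-- **`add`-membership ascends along base change**: if `X` is a retract of `Gᵐ` over `S`, then `S' ⊗ X` is a retract of
`(S' ⊗ G)ᵐ` over `S'` (`S' ⊗ Gᵐ ≅ (S' ⊗ G)ᵐ`). [cite: IyengarTakahashi2014, Definition 4.1] -/
theorem isRetractOfPower_baseChange {G X : ModuleCat.{u} S} (h : IsRetractOfPower G X) :
    IsRetractOfPower (ModuleCat.of S' (S' ⊗[S] G)) (ModuleCat.of S' (S' ⊗[S] X)) := by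
  obtain ⟨m, i, p, hip⟩ := h
  have hpi : p.hom ∘ₗ i.hom = LinearMap.id := by
    have h := congrArg ModuleCat.Hom.hom hip
    rwa [ModuleCat.hom_comp, ModuleCat.hom_id] at h
  let e : S' ⊗[S] (Fin m → G) ≃ₗ[S'] (Fin m → S' ⊗[S] G) := TensorProduct.piRight S S' S' (fun _ : Fin m => (G : Type u))
  refine ⟨m, ModuleCat.ofHom (e.toLinearMap ∘ₗ i.hom.baseChange S'),
    ModuleCat.ofHom (p.hom.baseChange S' ∘ₗ e.symm.toLinearMap), ?_⟩
  apply ModuleCat.hom_ext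
  rw [ModuleCat.hom_comp, ModuleCat.hom_ofHom, ModuleCat.hom_ofHom, ModuleCat.hom_id]
  apply LinearMap.ext
  intro x
  simp only [LinearMap.coe_comp, LinearEquiv.coe_coe, Function.comp_apply, LinearEquiv.symm_apply_apply,
    LinearMap.id_coe, id_eq]
  rw [← LinearMap.comp_apply (p.hom.baseChange S') (i.hom.baseChange S'), ← LinearMap.baseChange_comp, hpi,
    LinearMap.baseChange_id, LinearMap.id_apply]

/-- **Double duals of a retract**: `p ∘ i = id ⇒ p** ∘ i** = id`. [folklore] -/
theorem dualMap_dualMap_retract {A : Type u} [CommRing A] {X Z : Type u} [AddCommGroup X] [Module A X]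
    [AddCommGroup Z] [Module A Z] (i : X →ₗ[A] Z) (p : Z →ₗ[A] X) (h : p ∘ₗ i = LinearMap.id) :
    p.dualMap.dualMap ∘ₗ i.dualMap.dualMap = LinearMap.id := by
  rw [LinearMap.dualMap_comp_dualMap, LinearMap.dualMap_comp_dualMap, h, LinearMap.dualMap_id, LinearMap.dualMap_id]

/-! ## The transfer -/

/-- **COMPLETE HERZOG FROM LOCAL HERZOG.**  `S → S'` flat local of noetherian local rings, `𝔪S' = 𝔪'`, `S` dense in
`S'`, `S'` a domain of Krull dimension `2` and an isolated singularity; `V` a finitely generated `S`-module such that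
every second syzygy module (of a finitely generated module) over `S` is a retract of a power of `V`.  Then every second
syzygy module over `S'` is a retract of a power of `S' ⊗_S V`. [OURS · cell decomp-res] -/
theorem isRetractOfPower_of_isSyzygy_two_of_completionLike [IsNoetherianRing S] [IsNoetherianRing S'] [IsLocalRing S]
    [IsLocalRing S'] [Module.Flat S S'] [IsDomain S']
    (hmap : (maximalIdeal S).map (algebraMap S S') = maximalIdeal S')
    (hdense : ∀ (k : ℕ) (s : S'), ∃ r : S, s - algebraMap S S' r ∈ maximalIdeal S' ^ k)
    (hdim : ringKrullDim S' = (2 : ℕ)) (hiso : IsIsolatedSingularity S')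
    (V : ModuleCat.{u} S)
    (hHerzog : ∀ (M K : ModuleCat.{u} S), Module.Finite S M → IsSyzygy 2 M K → IsRetractOfPower V K)
    (M' K' : ModuleCat.{u} S') [Module.Finite S' M'] (hK' : IsSyzygy 2 M' K') :
    IsRetractOfPower (ModuleCat.of S' (S' ⊗[S] V)) K' := by
  haveI : Module.Finite S' K' := finite_of_isSyzygy 2 ‹_› hK'
  -- `K'` is punctured-free, hence a retract of a base change `S' ⊗ N`
  have hPF := puncturedFree_of_isSyzygy_of_isIsolatedSingularity hiso hdim hK'
  obtain ⟨N, _, _, hNfin, i, p, hpi⟩ := exists_retract_baseChange_of_puncturedFree 2 hmap hdense hdim K' ‹_› hPF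
  -- `K'` is reflexive
  haveI : Module.IsReflexive S' K' := isReflexive_of_isSyzygy_two M' K' hK'
  -- `N**` is a second syzygy over `S`, hence covered by `V`; base change the cover
  haveI : Module.Finite S (Module.Dual S N) := finite_dual_of_isNoetherianRing (R := S) (M := N)
  obtain ⟨X, hX, h2⟩ := exists_isSyzygy_two_dual (A := S) (Module.Dual S N)
  have hcov : IsRetractOfPower (ModuleCat.of S' (S' ⊗[S] V))
      (ModuleCat.of S' (S' ⊗[S] Module.Dual S (Module.Dual S N))) :=
    isRetractOfPower_baseChange S' (hHerzog X _ hX h2)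
  -- `S' ⊗ N** ≅ (S' ⊗ N)**`
  haveI : Module.FinitePresentation S N := Module.finitePresentation_of_finite S N
  let e₂ : S' ⊗[S] Module.Dual S (Module.Dual S N) ≃ₗ[S'] Module.Dual S' (Module.Dual S' (S' ⊗[S] N)) :=
    (isBaseChange_bidual S' (M := N)).equiv
  have hcov' : IsRetractOfPower (ModuleCat.of S' (S' ⊗[S] V))
      (ModuleCat.of S' (Module.Dual S' (Module.Dual S' (S' ⊗[S] N)))) :=
    hcov.of_iso e₂.toModuleIso
  -- `K'** ` is a retract of `(S' ⊗ N)**`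
  have hcov'' : IsRetractOfPower (ModuleCat.of S' (S' ⊗[S] V))
      (ModuleCat.of S' (Module.Dual S' (Module.Dual S' K'))) := by
    refine hcov'.of_retract (ModuleCat.ofHom i.dualMap.dualMap) (ModuleCat.ofHom p.dualMap.dualMap) ?_
    apply ModuleCat.hom_ext
    rw [ModuleCat.hom_comp, ModuleCat.hom_ofHom, ModuleCat.hom_ofHom, ModuleCat.hom_id]
    exact dualMap_dualMap_retract i p hpi
  -- `K' ≅ K'**`
  exact hcov''.of_iso (Module.evalEquiv S' K').symm.toModuleIso

end Summit.ResolutionOfSingularities.ResolutionOfSingularities.Theorems.HomologicalConductor.PersistenceSurfaceCompleteHerzogTransfer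

end
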